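import Literature.AnabelianGeometry.EtaleTheta.Discharge.Sec5PushforwardGaloisOuterRep
import Literature.AnabelianGeometry.EtaleTheta.Discharge.Sec4BaseEquivOfTemperoids
import Literature.AlgebraicGeometry.Frobenioids.QuasiTemperoidPushforwardSquareAut
import HarnessLib

/-!
# [FrdII] Def 2.2 (i) / Thm 2.4 (i): the outer representatives along a square — `outer_isoG` UP TO INNER AUTOMORPHISM

S. Mochizuki, *The geometry of Frobenioids II* [MochizukiFrdII2008], Def 2.2 (i) p.17 («the natural outer homomorphism
`G ↠ G_A`», determined up to composition with an inner automorphism), Thm 2.4 (i) p.19; *The étale theta function …*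
[MochizukiEtTh2009], Thm 4.4 (iii) p.95, Def 4.1 (ii) p.87 («natural … outer»).

For the square `ι ∘ φ = φ′ ∘ θ` of open surjections between tempered groups, `J : φ_* ⋙ B^temp(ι⁻¹) ≅ B^temp(θ⁻¹) ⋙ φ′_*`
the identity on representatives, Galois `A` over `Π₁`, `B` over `Π₁′` with `β : B ≅ B^temp(θ⁻¹)(A)`, representatives
`ρ_A : Π₂ → Aut(φ_* A)`, `ρ_B : Π₂′ → Aut(φ′_* B)` of the outer homomorphisms (abc-iut-w6-d047's
`exists_pushforwardOuterRep`) and the transport `E : Aut(φ_* A) ⥲ Aut(φ′_* B)` (abc-iut-w6-d047's `exists_squareAutEquiv`):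
**`E(ρ_A(x)) = ρ_B(c) · ρ_B(ι x) · ρ_B(c)⁻¹` for one `c ∈ Π₂′` and all `x ∈ Π₂`** — the field `outer_isoG` of the
[FrdII] Def 2.2 context isomorphism between `ctx_A` and `ctx_B.conjOuter c`.  Proof-only.
-/

namespace Literature.AnabelianGeometry.EtaleTheta

open CategoryTheory Opposite Literature.AlgebraicGeometry.Frobenioids Literature.AlgebraicGeometry.Frobenioids.QuasiTemperoid
  Literature.AnabelianGeometry.SemiGraphs Literature.AnabelianGeometry.SemiGraphs.GaloisObjects

universe u

namespace CnstPushforward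

variable {G₁ : Type u} [Group G₁] [TopologicalSpace G₁] [IsTopologicalGroup G₁]
  {G₂ : Type u} [Group G₂] [TopologicalSpace G₂]
  {G₁' : Type u} [Group G₁'] [TopologicalSpace G₁'] [IsTopologicalGroup G₁']
  {G₂' : Type u} [Group G₂'] [TopologicalSpace G₂']
  (φ : G₁ →* G₂) (hs : Function.Surjective φ) (hφ : IsOpenMap φ)
  (φ' : G₁' →* G₂') (hs' : Function.Surjective φ') (hφ' : IsOpenMap φ')
  (θ : G₁ ≃ₜ* G₁') (ι : G₂ ≃ₜ* G₂')

/-- **The Galois surjections of `A` and of `B ≅ B^temp(θ⁻¹)(A)` match along `θ` up to an inner automorphism, INSIDE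
`Aut(B)`**: there is `d ∈ Π₁′` with `β ∘ B^temp(θ⁻¹)(galoisSurjOf_A(g)) ∘ β⁻¹ = galoisSurjOf_B(d·θ(g)·d⁻¹)` for all
`g ∈ Π₁` — abc-iut-w5-d013's `galoisSurjOf_res` (along `B^temp(θ⁻¹)`) and `galoisSurjOf_iso_conj` (along `β`).
[cite: MochizukiEtTh2009, Def 4.1 (ii) p.313 (PDF p.87)] -/
theorem exists_conjAut_res_galoisSurjOf_eq (hG : IsTempered G₁) (hG' : IsTempered G₁')
    (A : ConnectedPart (BTemp G₁)) (hA : IsGaloisObj A.obj) (B : ConnectedPart (BTemp G₁')) (hB : IsGaloisObj B.obj)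
    (β : B.obj ≅ (BTemp.res (θ.symm : G₁' →ₜ* G₁)).obj A.obj) :
    ∃ d : G₁', ∀ g : G₁,
      β.symm.conjAut ((BTemp.res (θ.symm : G₁' →ₜ* G₁)).mapAut A.obj (galoisSurjOf hG A.obj hA g)) =
        galoisSurjOf hG' B.obj hB (d * θ g * d⁻¹) := by
  have hθs : Function.Surjective (θ.symm : G₁' →ₜ* G₁) := fun g => ⟨θ g, θ.symm_apply_apply g⟩
  have hresA : IsGaloisObj ((BTemp.res (θ.symm : G₁' →ₜ* G₁)).obj A.obj) := isGaloisObj_res hG _ hθs _ hA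
  obtain ⟨c₁, hc₁⟩ := galoisSurjOf_res hG hG' (θ.symm : G₁' →ₜ* G₁) hθs A.obj hA
  obtain ⟨c₂, hc₂⟩ := galoisSurjOf_iso_conj hG' β hB hresA
  refine ⟨c₂⁻¹ * c₁, fun g => Iso.ext ?_⟩
  rw [Iso.conjAut_hom, Iso.conj_apply, Iso.symm_inv, Iso.symm_hom]
  change β.hom ≫ (BTemp.res (θ.symm : G₁' →ₜ* G₁)).map (galoisSurjOf hG A.obj hA g).hom ≫ β.inv = _
  have h1 := hc₁ (θ g)
  rw [show (θ.symm : G₁' →ₜ* G₁) (θ g) = g from θ.symm_apply_apply g] at h1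
  have h2 := hc₂ (c₂⁻¹ * (c₁ * θ g * c₁⁻¹) * c₂)
  rw [show c₂ * (c₂⁻¹ * (c₁ * θ g * c₁⁻¹) * c₂) * c₂⁻¹ = c₁ * θ g * c₁⁻¹ by group] at h2
  rw [h1, ← h2, show c₂⁻¹ * c₁ * θ g * (c₂⁻¹ * c₁)⁻¹ = c₂⁻¹ * (c₁ * θ g * c₁⁻¹) * c₂ by group]
  simp only [Category.assoc, Iso.hom_inv_id, Category.comp_id, Iso.hom_inv_id_assoc]

/-- **[FrdII] Def 2.2 context isomorphism, field `outer_isoG`, UP TO INNER AUTOMORPHISM**: for representatives `ρ_A`,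
`ρ_B` of the outer homomorphisms `Π₂ ↠ Aut(φ_* A)`, `Π₂′ ↠ Aut(φ′_* B)` (intertwining `φ_* ∘ galoisSurjOf⁰` through `φ`,
resp. `φ′`) and a transport `E : Aut(φ_* A) ⥲ Aut(φ′_* B)` with `E(φ_*(σ)) = φ′_*(β⁻¹ ∘ B^temp(θ⁻¹)(σ) ∘ β)`, there is
`c ∈ Π₂′` with `E(ρ_A(x)) = ρ_B(c)·ρ_B(ι x)·ρ_B(c)⁻¹` for all `x ∈ Π₂` — i.e. `E` intertwines `ρ_A` with the
representative `conj(ρ_B c) ∘ ρ_B` (`Def22Context.conjOuter c`) along `ι`. [cite: MochizukiFrdII2008, Def 2.2 (i) p.17] -/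
theorem exists_outerRep_square (hsq : ∀ g : G₁, ι (φ g) = φ' (θ g)) (hG : IsTempered G₁) (hG' : IsTempered G₁')
    (A : ConnectedPart (BTemp G₁)) (hA : IsGaloisObj A.obj) (B : ConnectedPart (BTemp G₁')) (hB : IsGaloisObj B.obj)
    (β : B.obj ≅ (BTemp.res (θ.symm : G₁' →ₜ* G₁)).obj A.obj)
    {ρA : G₂ →* Aut ((pushforward φ hs hφ).obj A)}
    (hρA : ∀ g : G₁, ρA (φ g) = (pushforward φ hs hφ).mapAut A
      (((connectedObjects (BTemp G₁)).fullyFaithfulι.autMulEquivOfFullyFaithful A).symm (galoisSurjOf hG A.obj hA g)))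
    {ρB : G₂' →* Aut ((pushforward φ' hs' hφ').obj B)}
    (hρB : ∀ g : G₁', ρB (φ' g) = (pushforward φ' hs' hφ').mapAut B
      (((connectedObjects (BTemp G₁')).fullyFaithfulι.autMulEquivOfFullyFaithful B).symm
        (galoisSurjOf hG' B.obj hB g)))
    {E : Aut ((pushforward φ hs hφ).obj A) ≃* Aut ((pushforward φ' hs' hφ').obj B)}
    (hE : ∀ σ : Aut A, E ((pushforward φ hs hφ).mapAut A σ) =
      (pushforward φ' hs' hφ').mapAut B
        (((connectedObjects (BTemp G₁')).fullyFaithfulι.autMulEquivOfFullyFaithful B).symm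
          (β.symm.conjAut ((BTemp.res (θ.symm : G₁' →ₜ* G₁)).mapAut A.obj
            ((connectedObjects (BTemp G₁)).fullyFaithfulι.autMulEquivOfFullyFaithful A σ))))) :
    ∃ c : G₂', ∀ x : G₂, E (ρA x) = ρB c * ρB (ι x) * (ρB c)⁻¹ := by
  obtain ⟨d, hd⟩ := exists_conjAut_res_galoisSurjOf_eq θ hG hG' A hA B hB β
  refine ⟨φ' d, fun x => ?_⟩
  obtain ⟨g, rfl⟩ := hs x
  rw [hρA, hE, MulEquiv.apply_symm_apply, hd, ← hρB, hsq, map_mul φ', map_mul φ', map_inv φ', map_mul ρB,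
    map_mul ρB, map_inv ρB]

end CnstPushforward

end Literature.AnabelianGeometry.EtaleTheta
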